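import Mathlib
import Summits.CriticalPhenomena.PercolationContinuityZ3.Theorems.PercNearOneGluingNoHeavyLowerTailSahiCombTriWTiltCert

/-!
# The one-parameter tilt certificate conjecture `TiltCertIndep` is FALSE (explicit configuration at `#β + #γ = 6`, computational)

`FiveUpSet.TiltCertIndep` (prim-lf-1 gen 32, `…SahiCombTriWTiltCert`) asserts that for every up-set `P` and monotone family of up-sets `F` SOME rational `x` makes
the demand rows of the tilt certificate `T(x)` (`tiltCert x`) linearly independent; it was census-clean exhaustively through `#β + #γ = 5`.  The gen-20 census at
`#β + #γ = 6` (prim-masterthm-p5, kit j150010; evidence file `certgen-refuted-m6.md` on stmt-CriticalPhenomena-4575) found configurations where `T(x)` has rank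
`#rows − 1` for EVERY `x`.  This file decides the smallest one in the kernel-plus-compiler (`native_decide` for one finite rational identity, everything else `decide`):

* index cube `Finset (Fin 2)`, fibre cube `Finset (Fin 4)` (a subset `s` is read as the number `Σ_{j∈s} 2^j`);
* `P = cexP` = bit mask `0xffec` = `↑{x1, x3, x0x2}` (13 sets);  `F = cexF`: `F ∅ = 0xa000 = ↑{x0x2x3}`, `F {0} = F {1} = 0xaa00 = ↑{x0x3}`, `F {0,1} = 0xfaf0 = ↑{x2, x0x3}`;
* the KERNEL VECTOR `yvec x` — a polynomial vector of degree `≤ 5` in `x` supported on 20 of the 43 demand tokens (coefficient table `ycoef`), with the constant entry `1` at the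
  token `D₃(level ∅, point {1})` — satisfies `Σ_r yvec x r · tiltCert x r c = 0` for every supply token `c` and EVERY `x : ℚ`.
The identity is proved coefficientwise: `tiltCert x r c = Σ_{e<7} tce e r c · x^e` (`tiltCert_eq_sum_tce`, the entries are monomials), so the `x^j`-coefficient of the
combination is the finite rational sum `Σ_{k+e=j} Σ_r ycoef k r · tce e r c`, which vanishes for all `c` and `j < 12` (`cex_coeff_identity`, `native_decide`).  Hence
`yvec x` is a non-trivial vanishing combination of the rows for every `x`, and **`not_tiltCertIndep : ¬ TiltCertIndep`**.
The same four configurations refute the cylinder instances of `CertGenKernel` (`…SahiCombTriWCertGen`; same matrix in single-cube language) — not formalised here.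
What is NOT refuted: `TriWIneq` (on this configuration the Hall condition holds, even for the level-local support; memo `FROM-prim-masterthm-p5-g20-COMBO1.md` §7).
HONEST LABEL: refutation of a conjecture of this theory by an explicit finite witness; one `native_decide` (compiler-trusted evaluation of a closed rational identity,
proposed `--computational`), the rest kernel-checked. [this work]
-/

namespace Summit.CriticalPhenomena.PercolationContinuityZ3.Theorems

namespace FiveUpSet

open Finset

/-! ### The monomial structure of `tiltCert` -/

section general

variable {β γ : Type} [DecidableEq β] [DecidableEq γ]

/-- `tce e r c = 1` iff the entry `tiltCert x r c` is the monomial `x ^ e` (plain blocks: `e = 0`; tilted blocks: `e` = the distance), else `0`. [this work] -/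
def tce (e : ℕ) (r c : Token β γ) : ℚ :=
  if r.2.1 ⊆ c.2.1 ∧ r.2.2 ⊆ c.2.2 then
    (if (r.1 = 0 ∧ c.1 = 0) ∨ (r.1 = 1 ∧ c.1 = 1) ∨ (r.1 = 2 ∧ c.1 = 2) then (if e = 0 then (1 : ℚ) else 0)
     else if (r.1 = 0 ∧ c.1 = 1) ∨ (r.1 = 2 ∧ c.1 = 0) then (if (c.2.1 \ r.2.1).card + (c.2.2 \ r.2.2).card = e then (1 : ℚ) else 0)
     else 0)
  else 0

/-- The entries of `T(x)` are monomials: `tiltCert x r c = Σ_{e < N} tce e r c · x^e` as soon as `N` exceeds the distance `#(c.2.1 \ r.2.1) + #(c.2.2 \ r.2.2)`. [this work] -/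
theorem tiltCert_eq_sum_tce (x : ℚ) (r c : Token β γ) (N : ℕ) (hN : (c.2.1 \ r.2.1).card + (c.2.2 \ r.2.2).card < N) :
    tiltCert x r c = ∑ e ∈ range N, tce e r c * x ^ e := by
  have h0N : 0 < N := lt_of_le_of_lt (Nat.zero_le _) hN
  unfold tiltCert tce
  by_cases hs : r.2.1 ⊆ c.2.1 ∧ r.2.2 ⊆ c.2.2
  · simp only [if_pos hs]
    by_cases hp : (r.1 = 0 ∧ c.1 = 0) ∨ (r.1 = 1 ∧ c.1 = 1) ∨ (r.1 = 2 ∧ c.1 = 2)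
    · simp only [if_pos hp]
      rw [Finset.sum_eq_single 0]
      · simp
      · intro e _ he
        rw [if_neg he, zero_mul]
      · intro h
        exact absurd (mem_range.2 h0N) h
    · simp only [if_neg hp]
      by_cases ht : (r.1 = 0 ∧ c.1 = 1) ∨ (r.1 = 2 ∧ c.1 = 0)
      · simp only [if_pos ht]
        rw [Finset.sum_eq_single ((c.2.1 \ r.2.1).card + (c.2.2 \ r.2.2).card)]
        · simp
        · intro e _ he
          rw [if_neg (fun h => he h.symm), zero_mul]
        · intro h
          exact absurd (mem_range.2 hN) h
      · simp only [if_neg ht]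
        symm
        exact Finset.sum_eq_zero fun e _ => by rw [zero_mul]
  · simp only [if_neg hs]
    symm
    exact Finset.sum_eq_zero fun e _ => by rw [zero_mul]

end general

/-! ### The configuration and the kernel vector -/

/-- The family of subsets of `Fin 4` encoded by a bit mask (`s ↦ Σ_{j∈s} 2^j`). [this work] -/
def maskSet4 (m : ℕ) : Finset (Finset (Fin 4)) := univ.filter fun s => Nat.testBit m (∑ j ∈ s, 2 ^ (j : ℕ))

/-- The up-set `P` of the counterexample: mask `0xffec` (= `↑{x1, x3, x0x2}`). [this work] -/
def cexP : Finset (Finset (Fin 4)) := maskSet4 65516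

/-- The monotone family `F` of the counterexample: `F ∅ = 0xa000`, `F {0} = F {1} = 0xaa00`, `F {0,1} = 0xfaf0`. [this work] -/
def cexF (v : Finset (Fin 2)) : Finset (Finset (Fin 4)) :=
  if (0 : Fin 2) ∈ v then (if (1 : Fin 2) ∈ v then maskSet4 64240 else maskSet4 43520)
  else (if (1 : Fin 2) ∈ v then maskSet4 43520 else maskSet4 40960)

/-- Numeric code of the level of a token. [this work] -/
def levN (t : Token (Fin 2) (Fin 4)) : ℕ := ∑ j ∈ t.2.1, 2 ^ (j : ℕ)

/-- Numeric code of the fibre point of a token. [this work] -/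
def ptN (t : Token (Fin 2) (Fin 4)) : ℕ := ∑ j ∈ t.2.2, 2 ^ (j : ℕ)

/-- Coefficient of `x ^ k` in the entry of the polynomial kernel vector at the demand token `t` (tag `0/1/2` = `D₁/D₂/D₃`, level code, point code;
20 non-zero rows; found by `code20/py/kerpoly.py`). [this work] -/
def ycoef (k : ℕ) (t : Token (Fin 2) (Fin 4)) : ℚ :=
  match (t.1 : ℕ), levN t, ptN t, k with
  | 1, 0, 2, 3 => (1 : ℚ)
  | 1, 0, 3, 3 => (-2 : ℚ)
  | 1, 0, 3, 4 => (2 : ℚ)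
  | 1, 0, 6, 4 => (1 : ℚ)
  | 1, 0, 6, 5 => (-2 : ℚ)
  | 1, 0, 10, 3 => (-1 : ℚ)
  | 1, 0, 10, 4 => (1 : ℚ)
  | 1, 0, 11, 3 => (2 : ℚ)
  | 1, 0, 11, 4 => (-4 : ℚ)
  | 1, 0, 11, 5 => (2 : ℚ)
  | 2, 0, 2, 0 => (1 : ℚ)
  | 2, 0, 6, 0 => (-1 : ℚ)
  | 2, 0, 10, 0 => (1 : ℚ)
  | 2, 0, 10, 1 => (-1 : ℚ)
  | 1, 1, 2, 4 => (1 : ℚ)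
  | 1, 1, 2, 5 => (-2 : ℚ)
  | 1, 1, 6, 4 => (-1 : ℚ)
  | 1, 1, 6, 5 => (2 : ℚ)
  | 2, 1, 2, 0 => (-1 : ℚ)
  | 2, 1, 6, 1 => (1 : ℚ)
  | 1, 2, 2, 4 => (1 : ℚ)
  | 1, 2, 2, 5 => (-2 : ℚ)
  | 1, 2, 6, 4 => (-1 : ℚ)
  | 1, 2, 6, 5 => (2 : ℚ)
  | 2, 2, 2, 0 => (-1 : ℚ)
  | 2, 2, 6, 1 => (1 : ℚ)
  | 0, 3, 6, 3 => (-1 : ℚ)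
  | 0, 3, 7, 3 => (1 : ℚ)
  | 0, 3, 7, 4 => (-1 : ℚ)
  | 1, 3, 2, 4 => (-1 : ℚ)
  | 1, 3, 2, 5 => (2 : ℚ)
  | 2, 3, 2, 1 => (1 : ℚ)
  | _, _, _, _ => 0

/-- The polynomial kernel vector `y(x)`: `yvec x t = Σ_{k<6} ycoef k t · x^k`. [this work] -/
def yvec (x : ℚ) (t : Token (Fin 2) (Fin 4)) : ℚ := ∑ k ∈ range 6, ycoef k t * x ^ k

/-- The witness token `D₃(level ∅, point {1})`, where `yvec x = 1`. [this work] -/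
def cexTok : Token (Fin 2) (Fin 4) := (2, (∅, {1}))

/-! ### Decided facts -/

/-- Plumbing for `decide`: an up-set check over the finite powerset of `Fin 4`. [folklore] -/
private theorem isUpperSet_of_forall4 {A : Finset (Finset (Fin 4))}
    (h : ∀ a ∈ (univ : Finset (Finset (Fin 4))), ∀ b ∈ (univ : Finset (Finset (Fin 4))), a ⊆ b → a ∈ A → b ∈ A) :
    IsUpperSet (A : Set (Finset (Fin 4))) := fun a b hab ha =>
  mem_coe.2 (h a (mem_univ a) b (mem_univ b) hab (mem_coe.1 ha))

/-- Plumbing for `decide`: monotonicity of a family over the index cube `Finset (Fin 2)`. [folklore] -/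
private theorem monotone_of_forall2 {H : Finset (Fin 2) → Finset (Finset (Fin 4))}
    (h : ∀ x ∈ (univ : Finset (Finset (Fin 2))), ∀ y ∈ (univ : Finset (Finset (Fin 2))), x ⊆ y → H x ⊆ H y) :
    Monotone H := fun x y hxy => h x (mem_univ x) y (mem_univ y) hxy

/-- `cexP` is an up-set. [this work] -/
theorem isUpperSet_cexP : IsUpperSet (cexP : Set (Finset (Fin 4))) := isUpperSet_of_forall4 (by decide)

/-- Every `cexF v` is an up-set. [this work] -/
theorem isUpperSet_cexF (v : Finset (Fin 2)) : IsUpperSet (cexF v : Set (Finset (Fin 4))) := by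
  unfold cexF
  split_ifs <;> exact isUpperSet_of_forall4 (by decide)

/-- `cexF` is monotone. [this work] -/
theorem monotone_cexF : Monotone cexF := monotone_of_forall2 (by decide)

/-- The witness token is a demand token of the configuration. [this work] -/
theorem cexTok_mem : cexTok ∈ dipoleDem cexP cexF := by decide

/-- At the witness token the kernel vector is the constant `1`. [this work] -/
theorem yvec_cexTok (x : ℚ) : yvec x cexTok = 1 := by
  have h0 : ycoef 0 cexTok = 1 := by decide
  have h1 : ycoef 1 cexTok = 0 := by decide
  have h2 : ycoef 2 cexTok = 0 := by decide
  have h3 : ycoef 3 cexTok = 0 := by decide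
  have h4 : ycoef 4 cexTok = 0 := by decide
  have h5 : ycoef 5 cexTok = 0 := by decide
  simp [yvec, Finset.sum_range_succ, h0, h1, h2, h3, h4, h5]

/-- **The coefficient identities** (the finite rational computation behind the refutation): for every supply token `c` and every `j < 12`,
`Σ_{k<6, e<7, k+e=j} Σ_{r ∈ demand tokens} ycoef k r · tce e r c = 0`.  Decided by `native_decide`. [this work] -/
theorem cex_coeff_identity : ∀ c ∈ dipoleSup cexP cexF, ∀ j ∈ range 12,
    ∑ p ∈ (range 6 ×ˢ range 7).filter (fun p => p.1 + p.2 = j), ∑ r ∈ dipoleDem cexP cexF, ycoef p.1 r * tce p.2 r c = 0 := by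
  native_decide

/-! ### The vanishing combination and the refutation -/

/-- On the index cube `Fin 2` and fibre cube `Fin 4` every distance is `< 7`. [this work] -/
theorem dist_lt_seven (r c : Token (Fin 2) (Fin 4)) : (c.2.1 \ r.2.1).card + (c.2.2 \ r.2.2).card < 7 := by
  have h1 : (c.2.1 \ r.2.1).card ≤ 2 := by
    calc (c.2.1 \ r.2.1).card ≤ (univ : Finset (Fin 2)).card := card_le_card (subset_univ _)
      _ = 2 := by simp
  have h2 : (c.2.2 \ r.2.2).card ≤ 4 := by
    calc (c.2.2 \ r.2.2).card ≤ (univ : Finset (Fin 4)).card := card_le_card (subset_univ _)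
      _ = 4 := by simp
  omega

/-- **`y(x)·T(x) = 0` for every `x`**: the polynomial kernel vector is a vanishing combination of the demand rows of the tilt certificate at every supply token. [this work] -/
theorem yvec_tiltCert_sum_eq_zero (x : ℚ) (c : Token (Fin 2) (Fin 4)) (hc : c ∈ dipoleSup cexP cexF) :
    ∑ r ∈ dipoleDem cexP cexF, yvec x r * tiltCert x r c = 0 := by
  set D := dipoleDem cexP cexF with hD
  have step1 : ∑ r ∈ D, yvec x r * tiltCert x r c
      = ∑ r ∈ D, ∑ p ∈ range 6 ×ˢ range 7, (ycoef p.1 r * tce p.2 r c) * x ^ (p.1 + p.2) := by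
    refine sum_congr rfl fun r _ => ?_
    rw [yvec, tiltCert_eq_sum_tce x r c 7 (dist_lt_seven r c), Finset.sum_mul_sum, Finset.sum_product]
    refine sum_congr rfl fun k _ => sum_congr rfl fun e _ => ?_
    rw [pow_add]; ring
  have step2 : ∑ r ∈ D, ∑ p ∈ range 6 ×ˢ range 7, (ycoef p.1 r * tce p.2 r c) * x ^ (p.1 + p.2)
      = ∑ p ∈ range 6 ×ˢ range 7, (∑ r ∈ D, ycoef p.1 r * tce p.2 r c) * x ^ (p.1 + p.2) := by
    rw [Finset.sum_comm]
    refine sum_congr rfl fun p _ => ?_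
    rw [Finset.sum_mul]
  have hmaps : ∀ p ∈ range 6 ×ˢ range 7, (fun p : ℕ × ℕ => p.1 + p.2) p ∈ range 12 := by
    intro p hp
    rw [mem_product, mem_range, mem_range] at hp
    show p.1 + p.2 ∈ range 12
    rw [mem_range]
    omega
  have step3 : ∑ p ∈ range 6 ×ˢ range 7, (∑ r ∈ D, ycoef p.1 r * tce p.2 r c) * x ^ (p.1 + p.2)
      = ∑ j ∈ range 12, ∑ p ∈ (range 6 ×ˢ range 7).filter (fun p => p.1 + p.2 = j),
          (∑ r ∈ D, ycoef p.1 r * tce p.2 r c) * x ^ (p.1 + p.2) :=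
    (Finset.sum_fiberwise_of_maps_to hmaps _).symm
  rw [step1, step2, step3]
  refine Finset.sum_eq_zero fun j hj => ?_
  have inner : ∑ p ∈ (range 6 ×ˢ range 7).filter (fun p => p.1 + p.2 = j), (∑ r ∈ D, ycoef p.1 r * tce p.2 r c) * x ^ (p.1 + p.2)
      = (∑ p ∈ (range 6 ×ˢ range 7).filter (fun p => p.1 + p.2 = j), ∑ r ∈ D, ycoef p.1 r * tce p.2 r c) * x ^ j := by
    rw [Finset.sum_mul]
    refine sum_congr rfl fun p hp => ?_
    rw [(mem_filter.1 hp).2]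
  rw [inner, hD, cex_coeff_identity c hc j hj, zero_mul]

/-- **`TiltCertIndep` is false.**  On the configuration `(cexP, cexF)` over `Fin 2`, `Fin 4`, for EVERY `x : ℚ` the vector `yvec x` (equal to `1` at the demand token
`D₃(∅, {1})`) is a vanishing rational combination of the demand rows of `tiltCert x`, so the rows are never linearly independent. [this work] -/
theorem not_tiltCertIndep : ¬ TiltCertIndep := by
  intro h
  obtain ⟨x, hx⟩ := h (Fin 2) (Fin 4) cexP cexF isUpperSet_cexP isUpperSet_cexF monotone_cexF
  rw [Fintype.linearIndependent_iff] at hx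
  have hsum : ∑ r : ↥(dipoleDem cexP cexF), (yvec x r.1) • (fun c : ↥(dipoleSup cexP cexF) => tiltCert x r.1 c.1) = 0 := by
    funext c
    rw [Finset.sum_apply]
    simp only [Pi.smul_apply, smul_eq_mul, Pi.zero_apply]
    rw [Finset.sum_coe_sort (dipoleDem cexP cexF) (fun r => yvec x r * tiltCert x r c.1)]
    exact yvec_tiltCert_sum_eq_zero x c.1 c.2
  have hzero := hx (fun r => yvec x r.1) hsum ⟨cexTok, cexTok_mem⟩
  have hone : yvec x cexTok = 1 := yvec_cexTok x
  simp only at hzero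
  rw [hone] at hzero
  exact one_ne_zero hzero

end FiveUpSet

end Summit.CriticalPhenomena.PercolationContinuityZ3.Theorems
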